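import Literature.NumberTheory.LFunctions.AutomaticSequencePowTransducer
import HarnessLib

/-!
# The transducer of the power automaton, II: transitions, enumerations and outputs agree (Müllner 2017, Prop. 2.25; proved)

Everything in this file is PROVED. Continuing `AutomaticSequencePowTransducer.lean`: through the
equivalence `minImageEquivPow` of the state types (same minimal images), the transducer of the
power automaton `digitRestrict (k^p) (powδ k p δ)` reading a base-`k^p` digit word `W` and the
transducer of `δ` reading the concatenation of the blocks of `W` have

* the same transitions (`MinImage.minImageEquivPow_next`),
* enumerations with the same values (`MinImage.enum_val_powK`; both are `Finset.equivFinOfCardEq`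
  on the same subtype, only the target `Fin n₀` is indexed by the two (equal) ranks),
* outputs that correspond under `Fin.cast` (`MinImage.T_powK_val`): in particular `T = id` for one
  iff for the other (`MinImage.T_powK_eq_one_iff`).

This is the transport needed for the group half of Prop. 2.25 (`d = k₀ = 1` for the power
automaton with `p = d(A) k₀(A)`), which is not yet formalised.

## References
* C. Müllner, Duke Math. J. 166 (2017), Prop. 2.25 (proof). [Mullner2017]
-/

noncomputable section

open Finset

namespace Literature.NumberTheory.LFunctions

/-- Two `equivFinOfCardEq` enumerations of the same Finset have the same values. [folklore] -/
theorem Finset.equivFinOfCardEq_val_eq {α : Type*} {s : Finset α} {n m : ℕ} (h₁ : s.card = n)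
    (h₂ : s.card = m) (x : ↥s) :
    ((Finset.equivFinOfCardEq h₁ x : Fin n) : ℕ) = ((Finset.equivFinOfCardEq h₂ x : Fin m) : ℕ) := by
  subst h₁; subst h₂; rfl

namespace MinImage

variable {σ : Type*} [Fintype σ] [DecidableEq σ] {k p : ℕ}

/-- The equivalence of state types is the identity on the underlying images. [folklore] -/
@[simp] theorem coe_minImageEquivPow (hk : 2 ≤ k) (hp : 0 < p) (δ : σ → ℕ → σ)
    (htriv : ∀ q d, k ≤ d → δ q d = q) (M : MinImage (digitRestrict (k ^ p) (powδ k p δ))) :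
    ((minImageEquivPow hk hp δ htriv M : MinImage δ) : Finset σ) = (M : Finset σ) := rfl

/-- **Transitions agree**: `δ_K(M, W)` corresponds to `δ(M, blocks of W)`. [cite: Mullner2017, Prop. 2.25 (proof)] -/
theorem minImageEquivPow_next (hk : 2 ≤ k) (hp : 0 < p) (δ : σ → ℕ → σ)
    (htriv : ∀ q d, k ≤ d → δ q d = q) (M : MinImage (digitRestrict (k ^ p) (powδ k p δ)))
    {W : List ℕ} (hW : ∀ D ∈ W, D < k ^ p) :
    minImageEquivPow hk hp δ htriv (M.next W) =
      (minImageEquivPow hk hp δ htriv M).next (W.map (msbBlock k p)).flatten := by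
  apply Subtype.ext
  show (M.next W).1 = ((minImageEquivPow hk hp δ htriv M).next (W.map (msbBlock k p)).flatten).1
  rw [coe_next, coe_next]
  exact image_congr fun q _ => wordAct_powK k p δ hW q

/-- **Enumerations agree in value.** [folklore] -/
theorem enum_val_powK (hk : 2 ≤ k) (hp : 0 < p) (δ : σ → ℕ → σ)
    (htriv : ∀ q d, k ≤ d → δ q d = q) (M : MinImage (digitRestrict (k ^ p) (powδ k p δ)))
    (x : ↥(M : Finset σ)) :
    ((M.enum x : Fin (minRank (digitRestrict (k ^ p) (powδ k p δ)))) : ℕ) =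
      (((minImageEquivPow hk hp δ htriv M).enum x : Fin (minRank δ)) : ℕ) :=
  Finset.equivFinOfCardEq_val_eq _ _ x

/-- The enumeration of the power transducer is the `Fin.cast` of the other. [folklore] -/
theorem enum_powK_eq_cast (hk : 2 ≤ k) (hp : 0 < p) (δ : σ → ℕ → σ)
    (htriv : ∀ q d, k ≤ d → δ q d = q) (M : MinImage (digitRestrict (k ^ p) (powδ k p δ)))
    (x : ↥(M : Finset σ)) :
    M.enum x = Fin.cast (minRank_powK_eq hk hp δ htriv).symm ((minImageEquivPow hk hp δ htriv M).enum x) :=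
  Fin.ext (enum_val_powK hk hp δ htriv M x)

/-- **Outputs agree** (through `Fin.cast`): `T_K(M, W) i` and `T(M, blocks of W) (cast i)` have the same
value. [cite: Mullner2017, Prop. 2.25 (proof)] -/
theorem T_powK_val (hk : 2 ≤ k) (hp : 0 < p) (δ : σ → ℕ → σ)
    (htriv : ∀ q d, k ≤ d → δ q d = q) (M : MinImage (digitRestrict (k ^ p) (powδ k p δ)))
    {W : List ℕ} (hW : ∀ D ∈ W, D < k ^ p) (i : Fin (minRank (digitRestrict (k ^ p) (powδ k p δ)))) :
    ((M.T W i : Fin _) : ℕ) =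
      (((minImageEquivPow hk hp δ htriv M).T (W.map (msbBlock k p)).flatten
        (Fin.cast (minRank_powK_eq hk hp δ htriv) i) : Fin _) : ℕ) := by
  obtain ⟨x, rfl⟩ : ∃ x, M.enum x = i := M.enum.surjective i
  set e := minImageEquivPow hk hp δ htriv with he
  set w := (W.map (msbBlock k p)).flatten with hw
  have hcast : Fin.cast (minRank_powK_eq hk hp δ htriv) (M.enum x) = (e M).enum x := by
    rw [enum_powK_eq_cast hk hp δ htriv M x]; ext; rfl
  rw [hcast, T_apply_enum, T_apply_enum]
  -- both sides: enumeration of the image point in the next state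
  have hnext := minImageEquivPow_next hk hp δ htriv M hW
  have hval : ((M.actEquiv W x : ↥(M.next W).1) : σ) = ((e M).actEquiv w x : ↥((e M).next w).1) := by
    rw [coe_actEquiv, coe_actEquiv]
    exact wordAct_powK k p δ hW x
  have hmem : ((M.actEquiv W x : ↥(M.next W).1) : σ) ∈ ((e M).next w).1 := by
    rw [hval]; exact ((e M).actEquiv w x).2
  rw [enum_val_powK hk hp δ htriv (M.next W) (M.actEquiv W x)]
  have h1 : ((e (M.next W)).enum (M.actEquiv W x) : ℕ) =
      (((e M).next w).enum ⟨(M.actEquiv W x : σ), hmem⟩ : ℕ) := by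
    have := enum_congr hnext (M.actEquiv W x : σ) (M.actEquiv W x).2 hmem
    exact congrArg Fin.val this
  rw [h1]
  congr 2
  exact Subtype.ext hval

/-- **`T_K(M, W) = id ↔ T(M, blocks of W) = id`.** [cite: Mullner2017, Prop. 2.25 (proof)] -/
theorem T_powK_eq_one_iff (hk : 2 ≤ k) (hp : 0 < p) (δ : σ → ℕ → σ)
    (htriv : ∀ q d, k ≤ d → δ q d = q) (M : MinImage (digitRestrict (k ^ p) (powδ k p δ)))
    {W : List ℕ} (hW : ∀ D ∈ W, D < k ^ p) :
    M.T W = 1 ↔ (minImageEquivPow hk hp δ htriv M).T (W.map (msbBlock k p)).flatten = 1 := by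
  have hrank := minRank_powK_eq hk hp δ htriv
  constructor
  · intro h
    ext j
    obtain ⟨i, rfl⟩ : ∃ i, Fin.cast hrank i = j := ⟨Fin.cast hrank.symm j, by ext; rfl⟩
    rw [Equiv.Perm.one_apply, ← T_powK_val hk hp δ htriv M hW i, h, Equiv.Perm.one_apply]
    rfl
  · intro h
    ext i
    rw [T_powK_val hk hp δ htriv M hW i, h, Equiv.Perm.one_apply, Equiv.Perm.one_apply]
    rfl

end MinImage

end Literature.NumberTheory.LFunctions
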